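import Literature.Barriers.MatrixMultiplication.RectangularBarrier
import Literature.Barriers.MatrixMultiplication.UniversalMethodBarrierAsymptoticRank
import Literature.Computability.AlgebraicComplexity.RectangularExponentBounds
import HarnessLib

/-!
# Proof of the soundness of `T`-methods (CLLZ Thm. 2.1, Rem. 3.13): `CLLZ2025_tMethodBound_sound`

Topic `Literature/Barriers/MatrixMultiplication`. This file DISCHARGES the named fact
`CLLZ2025_tMethodBound_sound` of `RectangularBarrier.lean`
(`CLLZ2025_tMethodBound_sound_holds`): for every field `K` (in `Type`), every finite 3-tensor `T`,
`p ≥ 0` and every `T`-method bound `ω̂` on `ω(p)` (`IsTMethodBound K T p ω̂`: some `r ≥ R̃(T)` and,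
for every `ε > 0`, a restriction `T^{⊗k} ≥ ⟨s⟩ ⊗ ⟨n,n,m⟩` with `n ≥ 2`, `s ≥ 1`, `m ≥ n^{p−ε}`
and `k log_n r − log_n s ≤ ω̂ + ε`), both `ω(1,1,p) ≤ ω̂` and `ω(1,p,1) ≤ ω̂`
(`omegaRect`, `RectangularExponent.lean`).

Source: M. Christandl, F. Le Gall, V. Lysikov, J. Zuiddam, *Barriers for rectangular matrix
multiplication*, comput. complexity 34 (2025) (held text: arXiv:2003.03019v1,
`paper:arxiv-2003.03019`, §2 p. 6 and §3.3 p. 8): Thm. 2.1 "Let `m ≥ n^p`. If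
`R̃(⟨n,n,m⟩^{⊕s}) ≤ r`, then `s n^{ω(p)} ≤ r`" ("proven using the asymptotic sum inequality for
rectangular matrix multiplication [LR83] and the monotonicity of `ω(p)`"); Def. 3.9/3.10 "Then
Thm. 2.1 gives the upper bound `ω(p) ≤ ω̂(p)` where `ω̂(p) = inf {k log_n r − log_n s}`"; Rem. 3.13
"each reduction `T^{⊗k} ≥ ⟨n,n,m⟩^{⊕s}` gives an upper bound `ω(q) ≤ k log_n r − log_n s` where
`q = log_n m ≥ log_n f(n) → p`. As the function `ω(p)` is continuous [LR83], we get the required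
bound on `ω(p)` in the limit."

## Proof (everything PROVED; no named facts are used)

* `exists_tensorRank_kroneckerPow_le_of_asymptoticRank_lt` — `R̃(T) < r'` gives `M ≥ 1` with
  `R(T^{⊗(Mi)}) ≤ r'^{Mi}` for all `i` (`R̃` is an infimum; `R(T^{⊗(Mi)}) = R((T^{⊗M})^{⊗i}) ≤ R(T^{⊗M})ⁱ`,
  the tree's `tensorRank_kroneckerPow_mul`, `tensorRank_kroneckerPow_le`).
* `IsTMethodReduction.pow` — `T^{⊗k} ≥ ⟨s⟩ ⊗ ⟨n,n,m⟩ ⇒ T^{⊗(kN)} ≥ ⟨s^N⟩ ⊗ ⟨n^N,n^N,m^N⟩`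
  (the tree's `tensorRestrictsTo_kroneckerPow_add`, `TensorRestrictsTo.kronecker`,
  `tensorRestrictsTo_kronecker_multiple_matMulTensor`).
* `IsTMethodReduction.omegaRect_mul_log_add_log_le` — **Thm. 2.1 for one reduction**:
  `ω(1,1,q) log n + log s ≤ k log r` whenever `m ≥ n^q`, `q ≥ 0`, `R̃(T) ≤ r`. For `r' > r` and
  `N ∈ Mℕ`: `R(⟨s^N⟩ ⊗ ⟨n^N,n^N,m^N⟩) ≤ r'^{kN}`; with `Q = ⌊r'^{kN}/s^N⌋ + 1 ≤ 2r'^{kN}/s^N`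
  (flattening, `le_tensorRank_multiple`) the rectangular Lemma 7.7
  (`rpow_omegaRect_le_of_tensorRank_multiple_le`, `RectangularExponentBounds.lean` — the form in
  which Schönhage's asymptotic sum inequality enters) gives `n^{Nω(q)} ≤ Q`; logarithms, `N → ∞`,
  `r' → r`. `IsTMethodReduction.omegaRect_le_tMethodBound` restates it as
  `ω(1,1,q) ≤ tMethodBound r k n s`.
* `CLLZ2025_tMethodBound_sound_holds` — with `ε = δ/3` and `q = max(p − ε, 0)`: Thm. 2.1 gives
  `ω(1,1,q) ≤ ω̂ + ε`, the Lipschitz estimate `ω(1,1,p) ≤ ω(1,1,q) + (p − q)`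
  (`omegaRect_one_one_le_add`, the continuity of Rem. 3.13) gives `ω(1,1,p) ≤ ω̂ + 2ε`, and
  `ω(1,p,1) = ω(1,1,p)` (`omegaRect_one_mid_one`).
* Consequences: `IsTMethodAlphaBound.le_dualExponentAlpha` — a `T`-method lower bound `p ∈ [0,1]`
  on `α` satisfies `p ≤ dualExponentAlpha K` (soundness, `ω(1,p,1) ≥ 2`, `le_dualExponentAlpha`; this
  closes scope caveat (b) of the catalogue entry); with the entry's numerical fact
  `CLLZ2025_alpha_barrier_CW`, a `CW_q`-method bound is `≤ min(α, 0.625)`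
  (`CLLZ2025_alpha_barrier_CW.alpha_bound_le_min`).

## References

* M. Christandl, F. Le Gall, V. Lysikov, J. Zuiddam, comput. complexity 34 (2025), Thm. 2.1, §2,
  Def. 3.9, Def. 3.12, Rem. 3.13 (arXiv:2003.03019v1: Thm. 2.1, Def. 3.10, Def. 3.12, Rem. 3.13).
  [ChristandlLeGallLysikovZuiddam2025]
* M. Bläser, *Fast Matrix Multiplication*, ToC Graduate Surveys 5 (2013), Lemma 5.8, Thm. 5.9,
  Lemma 7.7 (the rank route to Schönhage's asymptotic sum inequality). [Blaser2013]
* M. Christandl, P. Vrana, J. Zuiddam, JAMS 36 (2023), §1.1 (asymptotic rank as an infimum).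
  [ChristandlVranaZuiddam2023]
-/

noncomputable section

open scoped BigOperators
open Filter

namespace Literature.Barriers.MatrixMultiplication

open Literature.Computability.AlgebraicComplexity

/-! ## Ranks of powers from the asymptotic rank -/

section Powers

variable {K : Type} [Field K] {ι κ μ : Type} [Fintype ι] [Fintype κ] [Fintype μ]

/-- **Rank of powers from the asymptotic rank**: if `R̃(t) < r'` then there is `M ≥ 1` with
`R(t^{⊗(M i)}) ≤ r'^{M i}` for all `i` (`R̃(t) = inf_M R(t^{⊗M})^{1/M}`, so some `R(t^{⊗M}) ≤ r'^M`,
and `R(t^{⊗(Mi)}) = R((t^{⊗M})^{⊗i}) ≤ R(t^{⊗M})ⁱ`, Bläser 2013 Lemma 5.8). Stated with an explicit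
exponent `e = M i`. [cite: ChristandlVranaZuiddam2023, §1.1] -/
theorem exists_tensorRank_kroneckerPow_le_of_asymptoticRank_lt (t : ι → κ → μ → K) {r' : ℝ}
    (hr : asymptoticRank t < r') :
    ∃ M : ℕ, 1 ≤ M ∧ ∀ e i : ℕ, e = M * i → (tensorRank (kroneckerPow t e) : ℝ) ≤ r' ^ e := by
  rw [asymptoticRank] at hr
  obtain ⟨N, hN⟩ := exists_lt_of_ciInf_lt hr
  have hM0 : (0 : ℝ) < (N : ℝ) + 1 := by positivity
  -- `R(t^{⊗(N+1)}) ≤ r'^(N+1)`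
  have hbase : (tensorRank (kroneckerPow t (N + 1)) : ℝ) ≤ r' ^ (N + 1) := by
    have h1 : ((tensorRank (kroneckerPow t (N + 1)) : ℝ) ^ ((N : ℝ) + 1)⁻¹) ^ ((N : ℝ) + 1) ≤
        r' ^ ((N : ℝ) + 1) :=
      Real.rpow_le_rpow (by positivity) hN.le hM0.le
    rw [← Real.rpow_mul (Nat.cast_nonneg _), inv_mul_cancel₀ hM0.ne', Real.rpow_one] at h1
    have e : r' ^ ((N : ℝ) + 1) = r' ^ (N + 1) := by
      have := Real.rpow_natCast r' (N + 1)
      push_cast at this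
      exact this
    rwa [e] at h1
  refine ⟨N + 1, Nat.succ_pos N, ?_⟩
  rintro e i rfl
  calc (tensorRank (kroneckerPow t ((N + 1) * i)) : ℝ)
      = tensorRank (kroneckerPow (kroneckerPow t (N + 1)) i) := by
        rw [mul_comm, tensorRank_kroneckerPow_mul t i (N + 1)]
    _ ≤ ((tensorRank (kroneckerPow t (N + 1)) ^ i : ℕ) : ℝ) := by
        exact_mod_cast tensorRank_kroneckerPow_le (kroneckerPow t (N + 1)) i
    _ = (tensorRank (kroneckerPow t (N + 1)) : ℝ) ^ i := by push_cast; rfl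
    _ ≤ (r' ^ (N + 1)) ^ i := pow_le_pow_left₀ (Nat.cast_nonneg _) hbase i
    _ = r' ^ ((N + 1) * i) := by rw [← pow_mul]

end Powers

/-! ## Powers of a reduction and CLLZ Theorem 2.1 -/

section TwoOne

variable {K : Type} [Field K] {ι κ μ : Type} [Fintype ι] [Fintype κ] [Fintype μ]

/-- **Powers of a reduction**: `T^{⊗k} ≥ ⟨s⟩ ⊗ ⟨n,n,m⟩` implies
`T^{⊗(kN)} ≥ ⟨s^N⟩ ⊗ ⟨n^N, n^N, m^N⟩` for every `N` (CLLZ §2: "`⟨s⟩^{⊗k} ⊗ ⟨n,n,m⟩^{⊗k} ≤ …`";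
induction: split `T^{⊗(kN+k)} ≥ T^{⊗kN} ⊗ T^{⊗k}` (`tensorRestrictsTo_kroneckerPow_add`), tensor the
two reductions, and `(⟨s^N⟩ ⊗ ⟨n^N,n^N,m^N⟩) ⊗ (⟨s⟩ ⊗ ⟨n,n,m⟩) ≥ ⟨s^{N+1}⟩ ⊗ ⟨n^{N+1}, n^{N+1}, m^{N+1}⟩`
(`tensorRestrictsTo_kronecker_multiple_matMulTensor`)).
[cite: ChristandlLeGallLysikovZuiddam2025, §2 (after Thm. 2.1)] -/
theorem IsTMethodReduction.pow {T : ι → κ → μ → K} {k n m s : ℕ}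
    (h : IsTMethodReduction K T k n m s) (N : ℕ) :
    TensorRestrictsTo (kroneckerPow T (k * N))
      (kroneckerTensor (unitTensor K (s ^ N)) (matMulTensor K (n ^ N) (n ^ N) (m ^ N))) := by
  classical
  unfold IsTMethodReduction at h
  induction N with
  | zero =>
    rw [Nat.mul_zero, pow_zero, pow_zero, pow_zero]
    have e : kroneckerTensor (unitTensor K 1) (matMulTensor K 1 1 1) = fun _ _ _ =>
        kroneckerPow T 0 (fun i => i.elim0) (fun i => i.elim0) (fun i => i.elim0) := by
      funext a b c
      simp [matMulTensor, Fin.fin_one_eq_zero]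
    rw [e]
    exact TensorRestrictsTo.comap _ _ _ _
  | succ N ih =>
    rw [Nat.mul_succ, pow_succ, pow_succ, pow_succ]
    exact (tensorRestrictsTo_kroneckerPow_add T (k * N) k).trans
      ((ih.kronecker h).trans
        (tensorRestrictsTo_kronecker_multiple_matMulTensor K (s ^ N) (n ^ N) (n ^ N) (m ^ N) s n n m))

/-- **CLLZ Theorem 2.1 with Def. 3.9, for one reduction (Schönhage's asymptotic sum inequality for
`⟨n,n,m⟩^{⊕s}` and the rectangular exponent):** if `T^{⊗k} ≥ ⟨s⟩ ⊗ ⟨n,n,m⟩` (`n ≥ 2`, `s ≥ 1`),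
`m ≥ n^q` (`q ≥ 0`) and `R̃(T) ≤ r`, then `ω(1,1,q) · log n + log s ≤ k · log r`, i.e.
`s · n^{ω(q)} ≤ r^k` (Thm. 2.1: "Let `m ≥ n^p`. If `R̃(⟨n,n,m⟩^{⊕s}) ≤ r`, then `s n^{ω(p)} ≤ r`";
Def. 3.9: each reduction gives "`ω(p) ≤ k log_n r − log_n s`"). Proof: for `r' > r` some
`R(T^{⊗M}) ≤ r'^M`; for `N ∈ Mℕ`, `R(⟨s^N⟩ ⊗ ⟨n^N,n^N,m^N⟩) ≤ R(T^{⊗kN}) ≤ r'^{kN}`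
(`IsTMethodReduction.pow`), so with `Q = ⌊r'^{kN}/s^N⌋ + 1 ≤ 2 r'^{kN}/s^N` (flattening:
`s^N ≤ r'^{kN}`) the rectangular form of Bläser's Lemma 7.7
(`rpow_omegaRect_le_of_tensorRank_multiple_le`) gives `n^{N ω(q)} ≤ Q`; take logarithms, divide by
`N → ∞`, then let `r' → r`. [cite: ChristandlLeGallLysikovZuiddam2025, Thm. 2.1 and Def. 3.9] -/
theorem IsTMethodReduction.omegaRect_mul_log_add_log_le {T : ι → κ → μ → K} {k n m s : ℕ}
    (h : IsTMethodReduction K T k n m s) (hn : 2 ≤ n) (hs : 1 ≤ s) {q : ℝ} (hq : 0 ≤ q)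
    (hqm : (n : ℝ) ^ q ≤ m) {r : ℝ} (hr : asymptoticRank T ≤ r) :
    omegaRect K 1 1 q * Real.log n + Real.log s ≤ k * Real.log r := by
  have hn0 : (0 : ℝ) < n := by exact_mod_cast (by omega : 0 < n)
  have hn1 : (1 : ℝ) < n := by exact_mod_cast (by omega : 1 < n)
  have hs0 : (0 : ℝ) < s := by exact_mod_cast hs
  have hm1 : 1 ≤ m := by
    have h1 : (1 : ℝ) ≤ (n : ℝ) ^ q := Real.one_le_rpow hn1.le hq
    exact_mod_cast h1.trans hqm
  have hω2 : 2 ≤ omegaRect K 1 1 q := two_le_omegaRect_one_one K q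
  have hL : 0 < Real.log n := Real.log_pos hn1
  have hlogs : 0 ≤ Real.log s := Real.log_nonneg (by exact_mod_cast hs)
  have hLHSpos : 0 < omegaRect K 1 1 q * Real.log n + Real.log s := by nlinarith
  set X : ℝ := omegaRect K 1 1 q * Real.log n + Real.log s with hX
  -- Step 1: the bound with any `r' > r` in place of `r`
  have step : ∀ r' : ℝ, r < r' → X ≤ k * Real.log r' := by
    intro r' hr'
    have hr'0 : 0 < r' := ((asymptoticRank_nonneg T).trans hr).trans_lt hr'
    obtain ⟨M, hM1, hM⟩ :=
      exists_tensorRank_kroneckerPow_le_of_asymptoticRank_lt T (hr.trans_lt hr')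
    -- for every `j ≥ 1`, with `N = M j`: `X ≤ k log r' + log 2 / j`
    have main : ∀ j : ℕ, 1 ≤ j → X ≤ k * Real.log r' + Real.log 2 / j := by
      intro j hj
      obtain ⟨N, hN⟩ : ∃ N : ℕ, N = M * j := ⟨_, rfl⟩
      have hN1 : 1 ≤ N := by
        rw [hN]; exact Nat.one_le_iff_ne_zero.2 (Nat.mul_ne_zero (by omega) (by omega))
      have hjN : j ≤ N := by rw [hN]; exact Nat.le_mul_of_pos_left j (by omega)
      have hNpos : (0 : ℝ) < N := by exact_mod_cast hN1
      have hsN0 : (0 : ℝ) < (s : ℝ) ^ N := pow_pos hs0 N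
      have hG0 : 0 < r' ^ (k * N) := pow_pos hr'0 _
      -- rank of the `N`-th power of the reduction
      have hrank : (tensorRank (kroneckerTensor (unitTensor K (s ^ N))
          (matMulTensor K (n ^ N) (n ^ N) (m ^ N))) : ℝ) ≤ r' ^ (k * N) :=
        calc (tensorRank (kroneckerTensor (unitTensor K (s ^ N))
              (matMulTensor K (n ^ N) (n ^ N) (m ^ N))) : ℝ)
            ≤ tensorRank (kroneckerPow T (k * N)) := by exact_mod_cast (h.pow N).tensorRank_le
          _ ≤ r' ^ (k * N) := hM (k * N) (k * j) (by rw [hN]; ring)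
      -- flattening: `s^N ≤ R(⟨s^N⟩ ⊗ ⟨n^N,n^N,m^N⟩) ≤ r'^{kN}`
      have hflat : (s : ℝ) ^ N ≤ r' ^ (k * N) := by
        refine le_trans ?_ hrank
        have hnN : 0 < n ^ N := pow_pos (by omega) N
        have hmN : 0 < m ^ N := pow_pos (by omega) N
        exact_mod_cast le_tensorRank_multiple (s ^ N) (matMulTensor K (n ^ N) (n ^ N) (m ^ N))
          (a₀ := (⟨0, hnN⟩, ⟨0, hmN⟩)) (b₀ := (⟨0, hnN⟩, ⟨0, hnN⟩)) (c₀ := (⟨0, hnN⟩, ⟨0, hmN⟩))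
          (by simp [matMulTensor])
      -- `Q = ⌊r'^{kN}/s^N⌋ + 1`
      set Q : ℕ := ⌊r' ^ (k * N) / (s : ℝ) ^ N⌋₊ + 1 with hQ
      have hQge : r' ^ (k * N) ≤ (Q : ℝ) * (s : ℝ) ^ N := by
        have h1 := Nat.lt_floor_add_one (r' ^ (k * N) / (s : ℝ) ^ N)
        rw [div_lt_iff₀ hsN0] at h1
        rw [hQ]
        push_cast
        exact h1.le
      have hQle : (Q : ℝ) ≤ 2 * (r' ^ (k * N) / (s : ℝ) ^ N) := by
        rw [hQ]
        push_cast
        have h1 : (⌊r' ^ (k * N) / (s : ℝ) ^ N⌋₊ : ℝ) ≤ r' ^ (k * N) / (s : ℝ) ^ N :=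
          Nat.floor_le (by positivity)
        have h2 : 1 ≤ r' ^ (k * N) / (s : ℝ) ^ N := by
          rw [le_div_iff₀ hsN0, one_mul]; exact hflat
        linarith
      have hmult : tensorRank (kroneckerTensor (unitTensor K (s ^ N))
          (matMulTensor K (n ^ N) (n ^ N) (m ^ N))) ≤ Q * s ^ N := by
        have h1 : (tensorRank (kroneckerTensor (unitTensor K (s ^ N))
            (matMulTensor K (n ^ N) (n ^ N) (m ^ N))) : ℝ) ≤ ((Q * s ^ N : ℕ) : ℝ) := by
          push_cast; exact hrank.trans hQge
        exact_mod_cast h1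
      -- the rectangular Lemma 7.7: `(n^N)^{ω(q)} ≤ Q`
      have hnN2 : 2 ≤ n ^ N := le_trans hn (Nat.le_self_pow (by omega) n)
      have hdim : ((n ^ N : ℕ) : ℝ) ^ q ≤ ((m ^ N : ℕ) : ℝ) := by
        rw [Nat.cast_pow, Nat.cast_pow, ← Real.rpow_natCast_mul hn0.le, mul_comm,
          Real.rpow_mul_natCast hn0.le]
        exact pow_le_pow_left₀ (Real.rpow_nonneg hn0.le q) hqm N
      have hC := rpow_omegaRect_le_of_tensorRank_multiple_le K hq (Nat.one_le_pow _ _ hs) hnN2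
        hdim hmult
      -- logarithms
      have hQ0 : (0 : ℝ) < Q := by rw [hQ]; positivity
      have hlog1 : omegaRect K 1 1 q * (N * Real.log n) ≤ Real.log Q := by
        have hpos : (0 : ℝ) < ((n ^ N : ℕ) : ℝ) ^ omegaRect K 1 1 q :=
          Real.rpow_pos_of_pos (by positivity) _
        have h1 := Real.log_le_log hpos hC
        rwa [Real.log_rpow (by positivity), Nat.cast_pow, Real.log_pow] at h1
      have hlog2 : Real.log Q ≤ Real.log 2 + (k * N) * Real.log r' - N * Real.log s := by
        have h1 := Real.log_le_log hQ0 hQle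
        rw [Real.log_mul (by norm_num) (by positivity), Real.log_div hG0.ne' hsN0.ne',
          Real.log_pow, Real.log_pow] at h1
        push_cast at h1
        linarith
      have hω0 : 0 ≤ omegaRect K 1 1 q := by linarith
      have hdiff : X - k * Real.log r' ≤ Real.log 2 / N := by
        rw [le_div_iff₀ hNpos, hX]
        nlinarith
      have hmono : Real.log 2 / N ≤ Real.log 2 / j :=
        div_le_div_of_nonneg_left (Real.log_nonneg one_le_two) (by exact_mod_cast hj)
          (by exact_mod_cast hjN)
      linarith
    refine le_of_forall_pos_lt_add fun η hη => ?_
    obtain ⟨j, hj⟩ := exists_nat_gt (Real.log 2 / η)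
    have hj0 : (0 : ℝ) < j := lt_of_le_of_lt (by positivity) hj
    have hj1 : 1 ≤ j := by exact_mod_cast hj0
    have hsmall : Real.log 2 / j < η := by
      rw [div_lt_iff₀ hj0]
      rw [div_lt_iff₀ hη] at hj
      linarith
    linarith [main j hj1]
  -- Step 2: `r' → r`
  by_contra hcon
  rw [not_le] at hcon
  rcases Nat.eq_zero_or_pos k with hk | hk
  · have h1 := step (r + 1) (by linarith)
    rw [hk] at h1
    simp at h1
    linarith
  · have hk0 : (0 : ℝ) < k := by exact_mod_cast hk
    rcases le_or_gt r 0 with hr0 | hr0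
    · have h1 := step (1 / 2) (by linarith)
      have hneg : Real.log (1 / 2) < 0 := Real.log_neg (by norm_num) (by norm_num)
      nlinarith
    · have hlt : r < Real.exp (X / k) := by
        rw [← Real.log_lt_iff_lt_exp hr0, lt_div_iff₀ hk0]
        linarith
      obtain ⟨r', h1, h2⟩ := exists_between hlt
      have h3 := step r' h1
      have hr'0 : 0 < r' := hr0.trans h1
      have h4 : Real.log r' < X / k := by rwa [Real.log_lt_iff_lt_exp hr'0]
      rw [lt_div_iff₀ hk0] at h4
      linarith

/-- The same in the form of CLLZ Def. 3.9: a single reduction bounds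
`ω(1,1,q) ≤ k log_n r − log_n s = tMethodBound r k n s` (`m ≥ n^q`, `q ≥ 0`).
[cite: ChristandlLeGallLysikovZuiddam2025, Thm. 2.1 and Def. 3.9] -/
theorem IsTMethodReduction.omegaRect_le_tMethodBound {T : ι → κ → μ → K} {k n m s : ℕ}
    (h : IsTMethodReduction K T k n m s) (hn : 2 ≤ n) (hs : 1 ≤ s) {q : ℝ} (hq : 0 ≤ q)
    (hqm : (n : ℝ) ^ q ≤ m) {r : ℝ} (hr : asymptoticRank T ≤ r) :
    omegaRect K 1 1 q ≤ tMethodBound r k n s := by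
  have h1 := h.omegaRect_mul_log_add_log_le hn hs hq hqm hr
  have hL : 0 < Real.log n := Real.log_pos (by exact_mod_cast (by omega : 1 < n))
  rw [tMethodBound, le_div_iff₀ hL]
  linarith

end TwoOne

/-! ## Discharge of `CLLZ2025_tMethodBound_sound` -/

/-- DISCHARGE of the named fact `CLLZ2025_tMethodBound_sound` (**CLLZ Thm. 2.1 with Def. 3.9 /
Def. 3.12 and Rem. 3.13: `T`-methods give true upper bounds on `ω(p)`, in both placements of the
rectangular dimension**). For every `ε > 0` the method supplies a reduction
`T^{⊗k} ≥ ⟨s⟩ ⊗ ⟨n,n,m⟩` with `m ≥ n^{p−ε}` and `k log_n r − log_n s ≤ ω̂ + ε`; Thm. 2.1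
(`IsTMethodReduction.omegaRect_le_tMethodBound`) bounds `ω(1,1,q) ≤ ω̂ + ε` for
`q = max(p − ε, 0)` (Rem. 3.13: "each reduction gives an upper bound `ω(q) ≤ k log_n r − log_n s`
where `q = log_n m`"), the continuity estimate `ω(1,1,p) ≤ ω(1,1,q) + (p − q)`
(`omegaRect_one_one_le_add`; Rem. 3.13: "as the function `ω(p)` is continuous, we get the required
bound on `ω(p)` in the limit") gives `ω(1,1,p) ≤ ω̂ + 2ε`, and `ω(1,p,1) = ω(1,1,p)`
(`omegaRect_one_mid_one`). [cite: ChristandlLeGallLysikovZuiddam2025, Thm. 2.1 and Rem. 3.13] -/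
theorem CLLZ2025_tMethodBound_sound_holds : CLLZ2025_tMethodBound_sound := by
  intro K _ ι κ μ _ _ _ T p ω hp hT
  suffices hmain : omegaRect K 1 1 p ≤ ω from ⟨hmain, by rwa [omegaRect_one_mid_one]⟩
  obtain ⟨r, hr, H⟩ := hT
  refine le_of_forall_pos_lt_add fun δ hδ => ?_
  obtain ⟨k, n, m, s, hn, hs, hm, hred, hb⟩ := H (δ / 3) (by positivity)
  set q : ℝ := max (p - δ / 3) 0 with hq
  have hq0 : 0 ≤ q := le_max_right _ _
  have hpq : p - q ≤ δ / 3 := by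
    have := le_max_left (p - δ / 3) 0
    linarith
  have hqp : q ≤ p := max_le (by linarith) hp
  have hqm : (n : ℝ) ^ q ≤ m := by
    rcases le_total (p - δ / 3) 0 with hle | hle
    · rw [hq, max_eq_right hle, Real.rpow_zero]
      have hpos : (0 : ℝ) < (n : ℝ) ^ (p - δ / 3) :=
        Real.rpow_pos_of_pos (by exact_mod_cast (by omega : 0 < n)) _
      have hm0 : 0 < m := by exact_mod_cast hpos.trans_le hm
      exact_mod_cast Nat.one_le_iff_ne_zero.2 hm0.ne'
    · rw [hq, max_eq_left hle]
      exact hm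
  have h1 : omegaRect K 1 1 q ≤ tMethodBound r k n s :=
    hred.omegaRect_le_tMethodBound hn hs hq0 hqm hr
  have h2 := omegaRect_one_one_le_add K hqp
  linarith

/-! ## Consequence: `T`-method lower bounds on `α` are lower bounds on `α` -/

/-- With soundness proved, **an asymptotic `T`-method proving that `p ∈ [0,1]` is a lower bound on
`α` (`IsTMethodAlphaBound K T p`, i.e. the method proves `ω(p) ≤ 2`, CLLZ Thm. 3.22 and its proof)
indeed certifies `p ≤ α = dualExponentAlpha K`**: `ω(1,p,1) ≤ 2` by soundness
(`CLLZ2025_tMethodBound_sound.omegaRect_le_two`), `ω(1,p,1) ≥ 2` by flattening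
(`two_le_omegaRect_one_one`, `omegaRect_one_mid_one`), and `le_dualExponentAlpha`. This closes the
chain "`T`-method `α`-bound ⟹ `p ≤ dualExponentAlpha`" left open in scope caveat (b) of the
catalogue entry `RectangularBarrier`. [cite: ChristandlLeGallLysikovZuiddam2025, Thm. 3.22 (proof)] -/
theorem IsTMethodAlphaBound.le_dualExponentAlpha {K : Type} [Field K] {ι κ μ : Type} [Fintype ι]
    [Fintype κ] [Fintype μ] {T : ι → κ → μ → K} {p : ℝ} (hp : p ∈ Set.Icc (0 : ℝ) 1)
    (h : IsTMethodAlphaBound K T p) : p ≤ dualExponentAlpha K := by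
  have h2 : omegaRect K 1 p 1 ≤ 2 := CLLZ2025_tMethodBound_sound_holds.omegaRect_le_two K hp.1 h
  have h2' : 2 ≤ omegaRect K 1 p 1 := by
    rw [omegaRect_one_mid_one]
    exact two_le_omegaRect_one_one K p
  exact Literature.Computability.AlgebraicComplexity.le_dualExponentAlpha K hp (le_antisymm h2 h2')

/-- In particular, with the headline numerics of the catalogue entry (`CLLZ2025_alpha_barrier_CW`,
v1 constant `0.625`): whatever lower bound `p ∈ [0,1]` on `α` a `CW_q`-method (`q ≥ 2`) certifies,
it certifies at most `min(α, 0.625)` — the method is sound (`p ≤ α`) and obstructed (`p ≤ 0.625`).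
[cite: ChristandlLeGallLysikovZuiddam2020, §1.3.1] -/
theorem CLLZ2025_alpha_barrier_CW.alpha_bound_le_min (hCW : CLLZ2025_alpha_barrier_CW) (K : Type) [Field K]
    {q : ℕ} (hq : 2 ≤ q) {p : ℝ} (hp : p ∈ Set.Icc (0 : ℝ) 1)
    (h : IsTMethodAlphaBound K
      (fun a b c : Fin (q + 2) =>
      if (a = 0 ∧ b = c ∧ b ≠ 0 ∧ b ≠ Fin.last (q + 1)) ∨
          (b = 0 ∧ a = c ∧ a ≠ 0 ∧ a ≠ Fin.last (q + 1)) ∨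
          (c = 0 ∧ a = b ∧ a ≠ 0 ∧ a ≠ Fin.last (q + 1)) ∨
          (a = 0 ∧ b = 0 ∧ c = Fin.last (q + 1)) ∨
          (a = 0 ∧ b = Fin.last (q + 1) ∧ c = 0) ∨
          (a = Fin.last (q + 1) ∧ b = 0 ∧ c = 0) then (1 : K) else 0) p) :
    p ≤ min (dualExponentAlpha K) 0.625 :=
  le_min (h.le_dualExponentAlpha hp) (hCW K q hq p h)

end Literature.Barriers.MatrixMultiplication

end
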